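import Summits.AtomisticToContinuum.Crystallization.Theorems.ChartedZeroExcessLayeredLatticeLiouvilleI

/-!
# ChartedZeroExcessLayered · LatticeLiouville — part J/10: §F «HalvingBasin», the second cut's glue (H♭ ⟸ H_pert ∧ K, H_pert ⟸ H), monotonicity, the `aHi = 1` pieces and the g26 columns
(decomp-a2c lens-2 generation 26; NEW content; imports part I — ONE namespace `…Theorems.ChartedZeroExcessLayeredLatticeLiouville`, linear chain).

COLUMNS (all kernel-checked here; P♭ ⟸ E ∧ Z and Z = `exactEndgame_of_le` from part G):
* ★★ `gap_and_pert_1_50_of_certs_16B` — SIX leaves, D-FREE: `LatticeLiouvilleCert → LayeredLiouvilleCert → R(2,1/16,1/16) → A∞(2,1/16,1/16) →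
  H♭(2,1/16) → HBG″ → VisibleGap (1/50) ∧ PertRegime (1/50)`.  LEAFWISE-JOINTLY WEAKER than v9's `_16h` {L, L_lay, R, D, H(2,1/16,1/64), HBG″}:
  `scaleExtinction_16_of_decay_halving : D → H(2,1/16,1/64) → A∞(2,1/16,1/16)` and `halvingBasin_of_flatnessHalving : H(2,1/16,1/64) → H♭(2,1/16)`
  (D is ABSORBED: it was only ever a way to bring all windows below H's literal basin 1/64; with the basin existential and A∞ qualitative it is moot).
* `gap_and_pert_1_50_of_certs_16E` — FIVE leaves through E(2,1/16,1/16) (= A∞ ∧ U; for the audit: the weakest typed form of the flatness slot).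
* `gap_and_pert_1_50_of_certs_16K` — SEVEN leaves, H♭ resolved: `… → R → A∞ → K(2,1/16) → H_pert(2,1/16) → HBG″ → …`; resolved ELEVEN-leaf audit
  column `gap_and_pert_1_50_of_layered_pieces_16K`; conservative `_16b` (keeps D, A∞ at 1/64); W-currency `doorPeriodicW_of_certs_16BW` /
  `gap_and_pert_1_50_of_certs_16BW` at pattern ceiling `103/100` (lens-4's slot `DoorPeriodicW 2` by `Iff.rfl`, as in part H).
«OLD ⟹ NEW» at the literals (the new columns are leafwise-jointly WEAKER than v9's `_16h`): `scaleExtinction_16_of_decay_halving`,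
`halvingBasin_16_of_halving`, `flatnessExtinction_16_of_decay_halving`; the W-pieces give the `aHi = 1` pieces (`scaleExtinction_of_W`, `halvingBasin_of_W`).
-/

noncomputable section

open scoped BigOperators InnerProductSpace RealInnerProductSpace
open MeasureTheory Set Metric Filter Topology
open Summit.AtomisticToContinuum.Crystallization.Theorems.ChartedPlanarOrderRigidityDoor (E3 IsClean IsNash IsCharted VisibleGap PertRegime atomsIn)
open Summit.AtomisticToContinuum.Crystallization.Theorems.ChartedPlanarOrderDensityDichotomy (μS IsSep nK nK_nonneg)
open Summit.AtomisticToContinuum.Crystallization.Theorems.ChartedPlanarOrderMesoCut (IsDoorSet NearHom LayeredHom EnvClose)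
open Summit.AtomisticToContinuum.Crystallization.Theorems.OverbindingBudgetLiouvilleDictionary (NearHomBD)
open Summit.AtomisticToContinuum.Crystallization.Theorems.ChartedPlanarOrderDoorLayered
  (TwoPeriodic DoorPeriodic PeriodicBulkGapDoor gap_and_pert_1_50_of_periodic NearHomL2BD nearHomL2BD_mono nearHomBD_of_nearHomL2BD
   sq_le_finsum_mem not_nearHomL2BD_singleton envClose_mono)
open Summit.AtomisticToContinuum.Crystallization.Theorems.ChartedPlanarOrderDoorLayeredOsc (IsTwoShellAffineGood DoorPeriodicOsc)
open Summit.AtomisticToContinuum.Crystallization.Theorems.ChartedPlanarOrderCleanScaleP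
  (IsCleanP IsDoorSetP DoorPeriodicP isDoorSetP_mono doorPeriodic_of_doorPeriodicP isDoorSetP_one_iff doorPeriodicP_one_iff)

namespace Summit.AtomisticToContinuum.Crystallization.Theorems.ChartedZeroExcessLayeredLatticeLiouville

/-! ## §F.4  The second cut H♭ ⟸ H_pert ∧ K (PROVED) and H_pert ⟸ H (PROVED) -/

/-- ★ **H♭ ⟸ H_pert ∧ K** (PROVED): with `C, M_K` from K(δ), apply H_pert at contraction `c = 1/(2C)` to get `τ₀, κ₀, M_P, R₀`; then K at that `τ₀`
gives `κ₁, R₀'`.  Basin `min κ₁ (κ₀/C)`, ratio `M_K·M_P`, floor `max R₀ R₀'`: `η`-flat at radius `M_K·M_P·R` ⇒(K) `C·η`-flat and `τ₀`-sup-flat at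
radius `M_P·R` ⇒(H_pert) `(1/(2C))·C·η = η/2`-flat at radius `R`. -/
theorem halvingBasinP_of_perturbative_core {aHi Λ θ : ℝ} (hPd : PerturbativeDecayP aHi Λ θ) (hK : CoreExclusionP aHi Λ θ) :
    HalvingBasinP aHi Λ θ := by
  intro hP hL δ hδ
  obtain ⟨C, hC, M', hM', hK'⟩ := hK hP hL δ hδ
  have hCpos : 0 < C := lt_of_lt_of_le one_pos hC
  obtain ⟨τ₀, hτ₀, κ₀, hκ₀, M, hM, R₀, hR₀, hstepP⟩ := hPd hP hL δ hδ (1 / (2 * C)) (by positivity)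
  obtain ⟨κ₁, hκ₁, R₀', hR₀', hstepK⟩ := hK' τ₀ hτ₀
  refine ⟨min κ₁ (κ₀ / C), lt_min hκ₁ (div_pos hκ₀ hCpos), M' * M, one_le_mul_of_one_le_of_one_le hM' hM,
    max R₀ R₀', hR₀.trans_le (le_max_left _ _), fun S hS hO η hη hηκ R hR hW => ?_⟩
  have hRnn : 0 ≤ R := hR₀.le.trans ((le_max_left _ _).trans hR)
  have hMR : R₀' ≤ M * R := ((le_max_right _ _).trans hR).trans (le_mul_of_one_le_left hRnn hM)
  have hW' : NearHomL2BD Λ η 4 S (atomsIn (μS S) 0 (M' * (M * R))) := by rw [← mul_assoc]; exact hW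
  have hsup := hstepK S hS hO η hη (hηκ.trans (min_le_left _ _)) (M * R) hMR hW'
  have hCη : C * η ≤ κ₀ := by
    have h1 : η ≤ κ₀ / C := hηκ.trans (min_le_right _ _)
    rw [le_div_iff₀ hCpos] at h1
    linarith [h1]
  have h2 := hstepP S hS hO (C * η) (by positivity) hCη R ((le_max_left _ _).trans hR) hsup
  have h3 : 1 / (2 * C) * (C * η) = η / 2 := by field_simp
  rw [h3] at h2
  exact h2

/-- ★ **H_pert ⟸ H(κ)** for every `κ > 0` (PROVED): iterate H along the windows `M^j·R` (level `η/2^j` from level η), choose `j` with `(1/2)^j < c`,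
ignore the sup clause (`nearHomL2BD_of_L2Sup`); `τ₀ := 1`, `κ₀ := κ`, ratio `M^j`. -/
theorem perturbativeDecayP_of_flatnessHalvingP {aHi Λ θ κ : ℝ} (hκ : 0 < κ) (hH : FlatnessHalvingP aHi Λ θ κ) :
    PerturbativeDecayP aHi Λ θ := by
  intro hP hL δ hδ c hc
  obtain ⟨M, hM, R₀, hR₀, hstep⟩ := hH hP hL δ hδ
  have iter : ∀ k : ℕ, ∀ S : Set E3, IsDoorSetP aHi δ S → (∀ q ∈ S, IsTwoShellAffineGood θ S q) →
      ∀ η : ℝ, 0 < η → η ≤ κ → ∀ R : ℝ, R₀ ≤ R →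
        NearHomL2BD Λ η 4 S (atomsIn (μS S) 0 (M ^ k * R)) → NearHomL2BD Λ (η / 2 ^ k) 4 S (atomsIn (μS S) 0 R) := by
    intro k
    induction k with
    | zero => intro S hS hO η hη hηκ R hR h; simpa using h
    | succ k ih =>
      intro S hS hO η hη hηκ R hR h
      have hRnn : 0 ≤ R := hR₀.le.trans hR
      have hMR : R₀ ≤ M * R := hR.trans (le_mul_of_one_le_left hRnn hM)
      have h' : NearHomL2BD Λ η 4 S (atomsIn (μS S) 0 (M ^ k * (M * R))) := by
        rw [← mul_assoc, ← pow_succ]; exact h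
      have h1 := ih S hS hO η hη hηκ (M * R) hMR h'
      have h2 := hstep S hS hO (η / 2 ^ k) (by positivity) ((div_le_self hη.le (one_le_pow₀ (by norm_num))).trans hηκ) R hR h1
      rwa [pow_succ, ← div_div]
  obtain ⟨k, hk⟩ := exists_pow_lt_of_lt_one hc (by norm_num : (1 / 2 : ℝ) < 1)
  refine ⟨1, one_pos, κ, hκ, M ^ k, one_le_pow₀ hM, R₀, hR₀, fun S hS hO η hη hηκ R hR hW => ?_⟩
  have h1 := iter k S hS hO η hη hηκ R hR (nearHomL2BD_of_L2Sup hW)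
  refine nearHomL2BD_mono ?_ h1
  have h4 : η / 2 ^ k = (1 / 2) ^ k * η := by rw [div_eq_mul_inv, ← inv_pow, one_div, mul_comm]
  rw [h4]
  exact mul_le_mul_of_nonneg_right hk.le hη.le

/-- hence **H♭ ⟸ H_pert ∧ K ⟸ H(κ) ∧ K** and the whole second cut is implied by v9's H together with K. -/
theorem halvingBasinP_of_flatnessHalvingP_core {aHi Λ θ κ : ℝ} (hκ : 0 < κ) (hH : FlatnessHalvingP aHi Λ θ κ) (hK : CoreExclusionP aHi Λ θ) :
    HalvingBasinP aHi Λ θ :=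
  halvingBasinP_of_perturbative_core (perturbativeDecayP_of_flatnessHalvingP hκ hH) hK

/-! ## §F.5  Monotonicity in the ceiling and in (θ, κ) -/

/-- A∞_P is ANTITONE in the ceiling (more door sets = a STRONGER statement). -/
theorem ScaleExtinctionP.anti {aHi aHi' Λ θ κ : ℝ} (hle : aHi ≤ aHi') (h : ScaleExtinctionP aHi' Λ θ κ) : ScaleExtinctionP aHi Λ θ κ :=
  fun hP hL δ hδ S hS => h hP hL δ hδ S (isDoorSetP_mono hle hS)

/-- A∞_P is ANTI-monotone in θ and in κ. -/
theorem ScaleExtinctionP.anti_anti {aHi Λ θ θ' κ κ' : ℝ} (hθ : θ ≤ θ') (hκ : κ ≤ κ') (h : ScaleExtinctionP aHi Λ θ' κ') :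
    ScaleExtinctionP aHi Λ θ κ :=
  fun hP hL δ hδ S hS hO hflat => h hP hL δ hδ S hS (fun q hq => (hO q hq).mono hθ) (fun R hR => nearHomL2BD_mono hκ (hflat R hR))

/-- U_P is ANTITONE in the ceiling. -/
theorem FlatnessUpgradeP.anti {aHi aHi' Λ θ κ : ℝ} (hle : aHi ≤ aHi') (h : FlatnessUpgradeP aHi' Λ θ κ) : FlatnessUpgradeP aHi Λ θ κ :=
  fun hP hL δ hδ S hS => h hP hL δ hδ S (isDoorSetP_mono hle hS)

/-- U_P is ANTI-monotone in θ and in κ. -/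
theorem FlatnessUpgradeP.anti_anti {aHi Λ θ θ' κ κ' : ℝ} (hθ : θ ≤ θ') (hκ : κ ≤ κ') (h : FlatnessUpgradeP aHi Λ θ' κ') :
    FlatnessUpgradeP aHi Λ θ κ :=
  fun hP hL δ hδ S hS hO hflat hev =>
    h hP hL δ hδ S hS (fun q hq => (hO q hq).mono hθ) (fun R hR => nearHomL2BD_mono hκ (hflat R hR)) hev

/-- H♭_P is ANTITONE in the ceiling. -/
theorem HalvingBasinP.anti {aHi aHi' Λ θ : ℝ} (hle : aHi ≤ aHi') (h : HalvingBasinP aHi' Λ θ) : HalvingBasinP aHi Λ θ := by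
  intro hP hL δ hδ
  obtain ⟨κ₀, hκ₀, M, hM, R₀, hR₀, hstep⟩ := h hP hL δ hδ
  exact ⟨κ₀, hκ₀, M, hM, R₀, hR₀, fun S hS => hstep S (isDoorSetP_mono hle hS)⟩

/-- H♭_P is ANTI-monotone in θ. -/
theorem HalvingBasinP.anti_θ {aHi Λ θ θ' : ℝ} (hθ : θ ≤ θ') (h : HalvingBasinP aHi Λ θ') : HalvingBasinP aHi Λ θ := by
  intro hP hL δ hδ
  obtain ⟨κ₀, hκ₀, M, hM, R₀, hR₀, hstep⟩ := h hP hL δ hδ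
  exact ⟨κ₀, hκ₀, M, hM, R₀, hR₀, fun S hS hO => hstep S hS (fun q hq => (hO q hq).mono hθ)⟩

/-- H_pert,P is ANTITONE in the ceiling. -/
theorem PerturbativeDecayP.anti {aHi aHi' Λ θ : ℝ} (hle : aHi ≤ aHi') (h : PerturbativeDecayP aHi' Λ θ) : PerturbativeDecayP aHi Λ θ := by
  intro hP hL δ hδ c hc
  obtain ⟨τ₀, hτ₀, κ₀, hκ₀, M, hM, R₀, hR₀, hstep⟩ := h hP hL δ hδ c hc
  exact ⟨τ₀, hτ₀, κ₀, hκ₀, M, hM, R₀, hR₀, fun S hS => hstep S (isDoorSetP_mono hle hS)⟩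

/-- K_P is ANTITONE in the ceiling. -/
theorem CoreExclusionP.anti {aHi aHi' Λ θ : ℝ} (hle : aHi ≤ aHi') (h : CoreExclusionP aHi' Λ θ) : CoreExclusionP aHi Λ θ := by
  intro hP hL δ hδ
  obtain ⟨C, hC, M, hM, hK⟩ := h hP hL δ hδ
  refine ⟨C, hC, M, hM, fun τ₀ hτ₀ => ?_⟩
  obtain ⟨κ₁, hκ₁, R₀, hR₀, hstep⟩ := hK τ₀ hτ₀
  exact ⟨κ₁, hκ₁, R₀, hR₀, fun S hS => hstep S (isDoorSetP_mono hle hS)⟩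

/-! ## §F.6  The pieces at `aHi = 1` (one line each through `_one_iff`) and «old ⟹ new» at the literals -/

/-- **E ⟺ A∞ ∧ U** (v9 binder). -/
theorem flatnessExtinction_iff_scale_upgrade (Λ θ κ : ℝ) : FlatnessExtinction Λ θ κ ↔ ScaleExtinction Λ θ κ ∧ FlatnessUpgrade Λ θ κ :=
  flatnessExtinctionP_iff_scale_upgrade 1 Λ θ κ

/-- **A∞ ⟸ E.** -/
theorem scaleExtinction_of_extinction {Λ θ κ : ℝ} (hE : FlatnessExtinction Λ θ κ) : ScaleExtinction Λ θ κ :=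
  (scaleExtinctionP_one_iff Λ θ κ).1 (scaleExtinctionP_of_extinction ((flatnessExtinctionP_one_iff Λ θ κ).2 hE))

/-- **U ⟸ E.** -/
theorem flatnessUpgrade_of_extinction {Λ θ κ : ℝ} (hE : FlatnessExtinction Λ θ κ) : FlatnessUpgrade Λ θ κ :=
  (flatnessUpgradeP_one_iff Λ θ κ).1 (flatnessUpgradeP_of_extinction ((flatnessExtinctionP_one_iff Λ θ κ).2 hE))

/-- ★ **U ⟸ H♭** at every κ. -/
theorem flatnessUpgrade_of_halvingBasin {Λ θ : ℝ} (κ : ℝ) (hH : HalvingBasin Λ θ) : FlatnessUpgrade Λ θ κ :=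
  (flatnessUpgradeP_one_iff Λ θ κ).1 (flatnessUpgradeP_of_halvingBasin κ ((halvingBasinP_one_iff Λ θ).2 hH))

/-- **H♭ ⟸ H(κ)**, `0 < κ`. -/
theorem halvingBasin_of_flatnessHalving {Λ θ κ : ℝ} (hκ : 0 < κ) (hH : FlatnessHalving Λ θ κ) : HalvingBasin Λ θ :=
  (halvingBasinP_one_iff Λ θ).1 (halvingBasinP_of_flatnessHalvingP hκ ((flatnessHalvingP_one_iff Λ θ κ).2 hH))

/-- ★ **E ⟸ A∞ ∧ H♭.** -/
theorem flatnessExtinction_of_scale_basin {Λ θ κ : ℝ} (hA : ScaleExtinction Λ θ κ) (hH : HalvingBasin Λ θ) : FlatnessExtinction Λ θ κ :=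
  (flatnessExtinctionP_one_iff Λ θ κ).1
    (flatnessExtinctionP_of_scale_basin ((scaleExtinctionP_one_iff Λ θ κ).2 hA) ((halvingBasinP_one_iff Λ θ).2 hH))

/-- ★★ **P♭ ⟸ A∞ ∧ H♭** (`Λ ≤ 4`). -/
theorem linearisedFlatnessLayered_of_scale_basin {Λ θ κ : ℝ} (hΛ : Λ ≤ 4) (hA : ScaleExtinction Λ θ κ) (hH : HalvingBasin Λ θ) :
    LinearisedFlatnessLayered Λ θ κ :=
  linearisedFlatnessLayered_of_extinction hΛ (flatnessExtinction_of_scale_basin hA hH)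

/-- ★ **H♭ ⟸ H_pert ∧ K.** -/
theorem halvingBasin_of_perturbative_core {Λ θ : ℝ} (hPd : PerturbativeDecay Λ θ) (hK : CoreExclusion Λ θ) : HalvingBasin Λ θ :=
  (halvingBasinP_one_iff Λ θ).1
    (halvingBasinP_of_perturbative_core ((perturbativeDecayP_one_iff Λ θ).2 hPd) ((coreExclusionP_one_iff Λ θ).2 hK))

/-- ★ **H_pert ⟸ H(κ)**, `0 < κ`. -/
theorem perturbativeDecay_of_flatnessHalving {Λ θ κ : ℝ} (hκ : 0 < κ) (hH : FlatnessHalving Λ θ κ) : PerturbativeDecay Λ θ :=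
  (perturbativeDecayP_one_iff Λ θ).1 (perturbativeDecayP_of_flatnessHalvingP hκ ((flatnessHalvingP_one_iff Λ θ κ).2 hH))

/-- **A∞ ⟸ H(κ)** (through E), `0 < κ`. -/
theorem scaleExtinction_of_halving {Λ θ κ : ℝ} (hκ : 0 < κ) (hH : FlatnessHalving Λ θ κ) : ScaleExtinction Λ θ κ :=
  scaleExtinction_of_extinction (flatnessExtinction_of_halving hκ hH)

/-- **E(κ₁) ⟸ D(κ₁, κ₀) ∧ E(κ₀)** — the decay piece D is only a way to lower the level at which E is invoked. -/
theorem flatnessExtinction_of_decay_extinction {Λ θ κ₁ κ₀ : ℝ} (hD : OscFlatnessDecay Λ θ κ₁ κ₀) (hE : FlatnessExtinction Λ θ κ₀) :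
    FlatnessExtinction Λ θ κ₁ :=
  fun hP hL δ hδ S hS hO hflat => hE hP hL δ hδ S hS hO (hD δ hδ S hS hO hflat)

/-- ★ **«old ⟹ new» (1): v9's D ∧ H(2,1/16,1/64) give A∞ at the RIGIDITY level 1/16** — the D-free six-leaf column `_16B` is leafwise-jointly WEAKER
than v9's `_16h`. -/
theorem scaleExtinction_16_of_decay_halving (hDec : OscFlatnessDecay 2 (1 / 16) (1 / 16) (1 / 64)) (hH : FlatnessHalving 2 (1 / 16) (1 / 64)) :
    ScaleExtinction 2 (1 / 16) (1 / 16) :=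
  scaleExtinction_of_extinction (flatnessExtinction_of_decay_extinction hDec (flatnessExtinction_of_halving (by norm_num) hH))

/-- ★ **«old ⟹ new» (2): v9's H(2,1/16,1/64) gives H♭(2,1/16)**. -/
theorem halvingBasin_16_of_halving (hH : FlatnessHalving 2 (1 / 16) (1 / 64)) : HalvingBasin 2 (1 / 16) :=
  halvingBasin_of_flatnessHalving (by norm_num) hH

/-- ★ **«old ⟹ new» (3): v9's D ∧ H(2,1/16,1/64) give E at the rigidity level 1/16** (so the five-leaf `_16E` is weaker than `_16h` too). -/
theorem flatnessExtinction_16_of_decay_halving (hDec : OscFlatnessDecay 2 (1 / 16) (1 / 16) (1 / 64)) (hH : FlatnessHalving 2 (1 / 16) (1 / 64)) :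
    FlatnessExtinction 2 (1 / 16) (1 / 16) :=
  flatnessExtinction_of_decay_extinction hDec (flatnessExtinction_of_halving (by norm_num) hH)

/-! ## §F.7  The g26 columns -/

/-- ★★ **COLUMN `_16B` — SIX leaves, D-FREE, basin existential**: `LatticeLiouvilleCert → LayeredLiouvilleCert → R(2,1/16,1/16) → A∞(2,1/16,1/16) →
H♭(2,1/16) → HBG″ → VisibleGap (1/50) ∧ PertRegime (1/50)` (P♭(2,1/16,1/16) ⟸ A∞ ∧ H♭, then part F's `_16r`). -/
theorem gap_and_pert_1_50_of_certs_16B (hL : LatticeLiouvilleCert) (hL' : LayeredLiouvilleCert) (hR : OscRigidityL2BD 2 (1 / 16) (1 / 16))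
    (hA : ScaleExtinction 2 (1 / 16) (1 / 16)) (hB : HalvingBasin 2 (1 / 16)) (hG : PeriodicBulkGapDoor 2) :
    VisibleGap (1 / 50) ∧ PertRegime (1 / 50) :=
  gap_and_pert_1_50_of_certs_16r hL hL' hR (linearisedFlatnessLayered_of_scale_basin (by norm_num) hA hB) hG

/-- ★ **COLUMN `_16E` — FIVE leaves through E(2,1/16,1/16) = A∞ ∧ U** (the weakest typed form of the flatness slot; U has no quantitative attack of
its own — its attack is H♭). -/
theorem gap_and_pert_1_50_of_certs_16E (hL : LatticeLiouvilleCert) (hL' : LayeredLiouvilleCert) (hR : OscRigidityL2BD 2 (1 / 16) (1 / 16))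
    (hE : FlatnessExtinction 2 (1 / 16) (1 / 16)) (hG : PeriodicBulkGapDoor 2) : VisibleGap (1 / 50) ∧ PertRegime (1 / 50) :=
  gap_and_pert_1_50_of_certs_16r hL hL' hR (linearisedFlatnessLayered_of_extinction (by norm_num) hE) hG

/-- ★ **COLUMN `_16U` — SIX leaves through A∞ ∧ U explicitly.** -/
theorem gap_and_pert_1_50_of_certs_16U (hL : LatticeLiouvilleCert) (hL' : LayeredLiouvilleCert) (hR : OscRigidityL2BD 2 (1 / 16) (1 / 16))
    (hA : ScaleExtinction 2 (1 / 16) (1 / 16)) (hU : FlatnessUpgrade 2 (1 / 16) (1 / 16)) (hG : PeriodicBulkGapDoor 2) :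
    VisibleGap (1 / 50) ∧ PertRegime (1 / 50) :=
  gap_and_pert_1_50_of_certs_16E hL hL' hR ((flatnessExtinction_iff_scale_upgrade _ _ _).2 ⟨hA, hU⟩) hG

/-- ★★ **COLUMN `_16K` — SEVEN leaves, H♭ RESOLVED into its perturbative and no-core halves**: `LatticeLiouvilleCert → LayeredLiouvilleCert →
R(2,1/16,1/16) → A∞(2,1/16,1/16) → K(2,1/16) → H_pert(2,1/16) → HBG″ → VisibleGap (1/50) ∧ PertRegime (1/50)`. -/
theorem gap_and_pert_1_50_of_certs_16K (hL : LatticeLiouvilleCert) (hL' : LayeredLiouvilleCert) (hR : OscRigidityL2BD 2 (1 / 16) (1 / 16))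
    (hA : ScaleExtinction 2 (1 / 16) (1 / 16)) (hK : CoreExclusion 2 (1 / 16)) (hPd : PerturbativeDecay 2 (1 / 16)) (hG : PeriodicBulkGapDoor 2) :
    VisibleGap (1 / 50) ∧ PertRegime (1 / 50) :=
  gap_and_pert_1_50_of_certs_16B hL hL' hR hA (halvingBasin_of_perturbative_core hPd hK) hG

/-- ★★ **COLUMN `_16K`, resolved form — ELEVEN leaves (the audit column)**: `LJDecay → LJMoments → CleanCrystalStability → LayeredDecay →
LayeredMoments → LayeredCrystalStability → R(2,1/16,1/16) → A∞(2,1/16,1/16) → K(2,1/16) → H_pert(2,1/16) → HBG″ → VisibleGap (1/50) ∧ PertRegime (1/50)`. -/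
theorem gap_and_pert_1_50_of_layered_pieces_16K (hD : LJDecay) (hM : LJMoments) (hC : CleanCrystalStability)
    (hD' : LayeredDecay) (hM' : LayeredMoments) (hC' : LayeredCrystalStability)
    (hR : OscRigidityL2BD 2 (1 / 16) (1 / 16)) (hA : ScaleExtinction 2 (1 / 16) (1 / 16)) (hK : CoreExclusion 2 (1 / 16))
    (hPd : PerturbativeDecay 2 (1 / 16)) (hG : PeriodicBulkGapDoor 2) : VisibleGap (1 / 50) ∧ PertRegime (1 / 50) :=
  gap_and_pert_1_50_of_certs_16K (latticeLiouvilleCert_of (latticeLinLiouville_of hD hM) hC) (layeredLiouvilleCert_of_pieces hD' hM' hC')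
    hR hA hK hPd hG

/-- **conservative COLUMN `_16b` — SEVEN leaves, keeps D and invokes A∞ only below v9's basin literal**: `LatticeLiouvilleCert → LayeredLiouvilleCert →
R(2,1/16,1/16) → D(2,1/16,1/16,1/64) → A∞(2,1/16,1/64) → H♭(2,1/16) → HBG″ → VisibleGap (1/50) ∧ PertRegime (1/50)`. -/
theorem gap_and_pert_1_50_of_certs_16b (hL : LatticeLiouvilleCert) (hL' : LayeredLiouvilleCert) (hR : OscRigidityL2BD 2 (1 / 16) (1 / 16))
    (hDec : OscFlatnessDecay 2 (1 / 16) (1 / 16) (1 / 64)) (hA : ScaleExtinction 2 (1 / 16) (1 / 64)) (hB : HalvingBasin 2 (1 / 16))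
    (hG : PeriodicBulkGapDoor 2) : VisibleGap (1 / 50) ∧ PertRegime (1 / 50) :=
  gap_and_pert_1_50_of_certs_16d hL hL' hR hDec (linearisedFlatnessLayered_of_scale_basin (by norm_num) hA hB) hG

/-- ★★ **THE `_16BW` COLUMN, door half** (W-currency of record, part H): `LatticeLiouvilleCert → LayeredLiouvilleCert → R_W(2, 103/1600, 1/16) →
A∞_W(2, 103/1600, 1/16) → H♭_W(2, 103/1600) → DoorPeriodicP 2 (103/100)` (= lens-4's slot `DoorPeriodicW 2` by `Iff.rfl`; D_W := the identity decay). -/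
theorem doorPeriodicW_of_certs_16BW (hL : LatticeLiouvilleCert) (hL' : LayeredLiouvilleCert)
    (hR : OscRigidityL2BDP (103 / 100) 2 (103 / 1600) (1 / 16)) (hA : ScaleExtinctionP (103 / 100) 2 (103 / 1600) (1 / 16))
    (hB : HalvingBasinP (103 / 100) 2 (103 / 1600)) : DoorPeriodicP 2 (103 / 100) :=
  doorPeriodicP_of_oscP (by norm_num)
    (doorPeriodicOscP_of_three hL hL' hR (fun _ _ _ _ _ h => h) (linearisedFlatnessLayeredP_of_scale_basin (by norm_num) hA hB))

/-- ★★ **THE `_16BW` COLUMN to the summit conjuncts — SIX leaves**: `LatticeLiouvilleCert → LayeredLiouvilleCert → R_W → A∞_W → H♭_W → HBG″ →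
VisibleGap (1/50) ∧ PertRegime (1/50)`. -/
theorem gap_and_pert_1_50_of_certs_16BW (hL : LatticeLiouvilleCert) (hL' : LayeredLiouvilleCert)
    (hR : OscRigidityL2BDP (103 / 100) 2 (103 / 1600) (1 / 16)) (hA : ScaleExtinctionP (103 / 100) 2 (103 / 1600) (1 / 16))
    (hB : HalvingBasinP (103 / 100) 2 (103 / 1600)) (hG : PeriodicBulkGapDoor 2) : VisibleGap (1 / 50) ∧ PertRegime (1 / 50) :=
  gap_and_pert_1_50_of_periodic (doorPeriodic_of_doorPeriodicP (by norm_num) (doorPeriodicW_of_certs_16BW hL hL' hR hA hB)) hG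

/-- ★ **THE `_16KW` COLUMN, door half — K_W and H_pert,W in place of H♭_W.** -/
theorem doorPeriodicW_of_certs_16KW (hL : LatticeLiouvilleCert) (hL' : LayeredLiouvilleCert)
    (hR : OscRigidityL2BDP (103 / 100) 2 (103 / 1600) (1 / 16)) (hA : ScaleExtinctionP (103 / 100) 2 (103 / 1600) (1 / 16))
    (hK : CoreExclusionP (103 / 100) 2 (103 / 1600)) (hPd : PerturbativeDecayP (103 / 100) 2 (103 / 1600)) : DoorPeriodicP 2 (103 / 100) :=
  doorPeriodicW_of_certs_16BW hL hL' hR hA (halvingBasinP_of_perturbative_core hPd hK)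

/-- the W-pieces give the `aHi = 1` pieces (ceiling `1 ≤ 103/100`, then `θ = 1/16 ≤ 103/1600` by antitonicity): `_16BW` is leafwise STRONGER than `_16B`. -/
theorem scaleExtinction_of_W (hA : ScaleExtinctionP (103 / 100) 2 (103 / 1600) (1 / 16)) : ScaleExtinction 2 (1 / 16) (1 / 16) :=
  (scaleExtinctionP_one_iff _ _ _).1 ((hA.anti (by norm_num)).anti_anti (by norm_num) le_rfl)

/-- likewise H♭_W(2, 103/1600) ⟹ H♭(2, 1/16). -/
theorem halvingBasin_of_W (hB : HalvingBasinP (103 / 100) 2 (103 / 1600)) : HalvingBasin 2 (1 / 16) :=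
  (halvingBasinP_one_iff _ _).1 ((hB.anti (by norm_num)).anti_θ (by norm_num))

end Summit.AtomisticToContinuum.Crystallization.Theorems.ChartedZeroExcessLayeredLatticeLiouville

end
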